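import Summits.BirchSwinnertonDyer.Rank1Residual.JET.RingClassTransverseLocal
import Summits.BirchSwinnertonDyer.Rank1Residual.X5.TransverseSelfDual
import Summits.BirchSwinnertonDyer.Rank1Residual.GaloisImage.KolyvaginPrimeTransverse
import HarnessLib

/-!
# T1 JET (cell `bsd-jet`), road K: Jetchev's transverse condition `H¹_tr(K_λ, E[p^k])` at a Kolyvagin
# prime is ISOTROPIC for the Weil cup product and has exactly `#E(K_λ)[p^k]` elements
# (typer seat `bsd-jet-ty` g7; inputs of the Lagrangian statement = binder `h𝒯sd` of the H63 line,
# sibling `JET/RingClassTransverseLagrangian.lean`; 0 classes move)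

HONEST FRAMING (programme file §HONESTY, verbatim): «no tranche here proves BSD; ARM L moves the
LITERAL column of an r ≤ 1 census into the kernel-proved-modulo-named-print column.» THEOREMS ONLY
(no definition, no named fact, no `sorry`); nothing is booked; typed ≠ proved ≠ endorsed.

WHAT. For `W/ℚ` elliptic, `K` imaginary quadratic with `d_K < −4`, `ι : K → ℂ`, an odd prime `p`, a level
`k`, a Kolyvagin prime `ℓ` of W. Zhang (`Zhang2014.IsKolyvaginPrime`; with `k ≤ M(ℓ)`, i.e. `p^k ∣ ℓ + 1`,
`p^k ∣ a_ℓ`, for the count), `v = λ = (ℓ)` and any place `w' ∣ λ` of `K[ℓ]`, with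
`Tr := transverseSubgroup (E[p^k]|_{K_λ}) (K[ℓ]_{w'}) = ker(H¹(K_λ, E[p^k]) → H¹(K[ℓ]_{w'}, E[p^k]))` (tree
`DiscreteGaloisModule.transverseSubgroup`, Mazur–Rubin Def. 1.1.6; Jetchev §3.1.2
`H¹_tr(K_λ) := H¹(K[ℓ]_λ/K_λ, E[p^k])`), and `Φ : Γ_{K_λ} → G_ℓ` the character of the sibling
`JET/RingClassTransverseLocal.lean` (kernel `Γ_{K[ℓ]_{w'}}`, onto on inertia, `G_ℓ` cyclic of order `ℓ + 1`):
* §0 `apply_eq_self_of_forall_ker_of_inertia` — `M^{ker Φ} = M^{Γ_F}` for an unramified `M` and a character all of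
  whose values are attained on inertia (`Γ_F = I_F · ker Φ`).
* §1 `weilCupProduct_eq_zero_of_mem_transverseSubgroup_ringClassField` — ISOTROPY: two classes of `Tr` cup to zero
  under the Weil cup product into `H²(K_λ, μ_{p^k})` (Mazur–Rubin Prop. 1.3.2 (ii) mechanism at odd exponent, tree
  `TransverseCup.cupProduct_eq_zero_of_principal_of_cyclic`: both classes principal on `ker Φ`, values fixed since
  `E[p^k]^{ker Φ} = E[p^k]^{Γ_{K_λ}}` (good reduction at `λ ∤ p`), cyclic quotient `G_ℓ`, `μ_{p^k}` killed by the
  odd `p^k`).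
* §2 `natCard_transverseSubgroup_ringClassField_eq` — THE COUNT `#Tr = #E(K_λ)[p^k]`: inflation–restriction
  `Tr ≅ H¹(G_ℓ, E[p^k]^{Γ_{K_λ}}) ≅ Hom(G_ℓ, E(K_λ)[p^k])` (`infOne_exact_resSubgroup`, the quotient acting
  trivially), `G_ℓ` cyclic of order `ℓ + 1` with `p^k ∣ ℓ + 1`, and `#E[p^k]^{Γ_{K_λ}} = #E(K_λ)[p^k]`
  (`natCard_invariants_torsion_restrictField`) — Rubin PCMI Prop. 1.9.5 (1) «`H¹_tr ≅ Hom(Gal(L/K), A^{Frob=1})`».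

No «`Γ_{K_λ}` fixes `E[p^k]`» input is used.  References: [cite: MazurRubin2004, Def. 1.1.6, Lemma 1.2.1,
Prop. 1.3.2 (ii) (p. 12)] [cite: Rubin2011, Def. 1.9.4, Prop. 1.9.5 (pp. 14–16)] [cite: Howard2004HeegnerKolyvagin,
Prop. 2.1.7, Prop. 2.1.9 (ii)] [cite: Jetchev2008, §3.1.2 (p. 814)] [cite: GrossLMS1991, §3 (p. 218 l. 1)]
[cite: SilvermanAEC2009, Prop. VII.4.1].

## Tree search
`lean search 'cupProduct_eq_zero_of_mem_transverse|natCard_transverseSubgroup|natCard_cyclotomicTransverse'`: the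
CYCLOTOMIC twins `X5/TransverseSelfDual.weilCupProduct_eq_zero_of_mem_transverseSubgroup` (needs `e ≡ 1` on the fixed
points) and `GaloisImage/KolyvaginPrimeTransverse.natCard_cyclotomicTransverse_of_mem_frobeniusClassPrimes`
(`L = K_v(μ_ℓ)`), and the GLOBAL `p = 3` isotropy `KolyLocal.cupProduct_eq_zero_of_mem_transverseLocalKer`; no
ring-class-field statement at level `p^k` — this file supplies it with the same abstract bricks.
-/

set_option autoImplicit false

noncomputable section

open scoped Classical Pointwise

namespace Summit.BirchSwinnertonDyer.Rank1Residual.JET.RingClassTransverse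

open CategoryTheory ContinuousCohomology WeierstrassCurve Field Function NumberField IsDedekindDomain
open Literature.NumberTheory.EllipticCurves
open Literature.NumberTheory.GaloisRepresentations Literature.NumberTheory.GaloisCohomology
open Literature.NumberTheory.GaloisRepresentations.DiscreteGaloisModule (mu MuCarrier transverseSubgroup SelmerStructure)
open Literature.NumberTheory.Automorphic _root_.TopRep
open Summit.BirchSwinnertonDyer.Rank1Residual.GaloisImage
open Summit.BirchSwinnertonDyer.Rank1Residual.X11b.FiniteDuality
open scoped ContRepresentation NumberField


/-! ## §0 `M^{ker Φ} = M^{Γ}` for an unramified `M` and a character onto on inertia -/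

/-- On an unramified local module, `M^{ker Φ} = M^{Γ_F}` as soon as every value of `Φ` is attained on the
inertia group (`Γ_F = I_F · ker Φ`). (The `Φ`-version of `GaloisImage.apply_eq_self_of_forall_ker`.) [folklore] -/
theorem apply_eq_self_of_forall_ker_of_inertia {F : Type} [Field F] [ValuativeRel F] [TopologicalSpace F]
    [IsNonarchimedeanLocalField F] {M : Type} [AddCommGroup M] [TopologicalSpace M] [DiscreteTopology M]
    (ρF : DiscreteGaloisModule F M) {G : Type*} [Group G] (Φ : absoluteGaloisGroup F →* G)
    (hI : ∀ t ∈ absInertia F, ∀ m : M, ρF t m = m) (hΦI : ∀ d, ∃ t ∈ absInertia F, Φ t = Φ d)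
    (g : absoluteGaloisGroup F) (m : M) (hm : ∀ h, Φ h = 1 → ρF h m = m) : ρF g m = m := by
  obtain ⟨t, ht, htg⟩ := hΦI g
  have hker : Φ (t⁻¹ * g) = 1 := by rw [map_mul, map_inv, htg, inv_mul_cancel]
  calc ρF g m = ρF (t * (t⁻¹ * g)) m := by rw [mul_inv_cancel_left]
    _ = ρF t (ρF (t⁻¹ * g) m) := by rw [map_mul, Module.End.mul_apply]
    _ = m := by rw [hm _ hker, hI t ht m]

variable (W : WeierstrassCurve ℚ) [W.IsElliptic] [W.IsGloballyMinimal] (K : Type) [Field K] [NumberField K]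

/-! ## §1 ISOTROPY: two transverse classes cup to zero -/

/-- **Isotropy of `H¹_tr(K_λ, E[p^k])` for the Weil cup product at a Kolyvagin prime** (`p` odd).  For `a, b`
in `Tr = ker(H¹(K_λ, E[p^k]) → H¹(K[ℓ]_{w'}, E[p^k]))`: `a ∪ₑ b = 0` in `H²(K_λ, μ_{p^k})`.  Mazur–Rubin
Prop. 1.3.2 (ii) mechanism (tree `TransverseCup.cupProduct_eq_zero_of_principal_of_cyclic`): both classes are
principal on `ker Φ` (sibling `ringClassCharacter_eq_one_iff_mem_range`), `E[p^k]^{ker Φ} = E[p^k]^{Γ_{K_λ}}` (unramified +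
`Φ` onto on inertia), the image `G_ℓ` is cyclic, and `μ_{p^k}` is killed by the odd `p^k`.
(The compactness of `Γ_{K_λ}` — tree `absoluteGaloisGroup_compactSpace` — enters as an instance binder; no local
instance attribute is used in this file.)
[cite: MazurRubin2004, Prop. 1.3.2 (ii) (p. 12)] [cite: Howard2004HeegnerKolyvagin, Prop. 2.1.9 (ii)] -/
theorem weilCupProduct_eq_zero_of_mem_transverseSubgroup_ringClassField (hK : IsImaginaryQuadratic K)
    (hD : NumberField.discr K < -4) (ι : K →+* ℂ) [∀ j : ℕ, NumberField (ringClassField K ι j)]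
    {p : ℕ} (hp : p.Prime) (hp2 : p ≠ 2) (k : ℕ) [NeZero (p ^ k)]
    {ℓ : ℕ} (hℓ : Zhang2014.IsKolyvaginPrime (W.conductorNorm ℤ) W K p ℓ)
    (v : HeightOneSpectrum (𝓞 K)) (hv : (ℓ : 𝓞 K) ∈ v.asIdeal)
    [CompactSpace (absoluteGaloisGroup (Place.Completion (Sum.inr v : Place K)))]
    (w' : HeightOneSpectrum (𝓞 (ringClassField K ι ℓ))) [w'.asIdeal.LiesOver v.asIdeal]
    (e : geomTorsion (W.baseChange K) ((p ^ k : ℕ) : ℤ) → geomTorsion (W.baseChange K) ((p ^ k : ℕ) : ℤ) →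
      AlgebraicClosure K)
    (hμ : ∀ S T, e S T ^ (p ^ k) = 1)
    (hadd₁ : ∀ S₁ S₂ T, e (S₁ + S₂) T = e S₁ T * e S₂ T)
    (hadd₂ : ∀ S T₁ T₂, e S (T₁ + T₂) = e S T₁ * e S T₂)
    (hgal : ∀ (g : absoluteGaloisGroup K) (S T : geomTorsion (W.baseChange K) ((p ^ k : ℕ) : ℤ)),
      g • e S T = e (g • S) (g • T))
    {a b : galoisCohomology (GaloisRep.toLocal v ((W.baseChange K).torsionGaloisModule ((p ^ k : ℕ) : ℤ))) 1}
    (ha : a ∈ (letI := (adicCompletionOfLiesOver K (ringClassField K ι ℓ) v w').toAlgebra;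
      transverseSubgroup (GaloisRep.toLocal v ((W.baseChange K).torsionGaloisModule ((p ^ k : ℕ) : ℤ)))
        (w'.adicCompletion (ringClassField K ι ℓ))))
    (hb : b ∈ (letI := (adicCompletionOfLiesOver K (ringClassField K ι ℓ) v w').toAlgebra;
      transverseSubgroup (GaloisRep.toLocal v ((W.baseChange K).torsionGaloisModule ((p ^ k : ℕ) : ℤ)))
        (w'.adicCompletion (ringClassField K ι ℓ)))) :
    (weilContPairingLocal (W.baseChange K) (p ^ k) e hμ hadd₁ hadd₂ hgal (Sum.inr v)).cupProduct a b = 0 := by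
  haveI : CompactSpace (absoluteGaloisGroup (v.adicCompletion K)) :=
    ‹CompactSpace (absoluteGaloisGroup (Place.Completion (Sum.inr v : Place K)))›
  letI := (adicCompletionOfLiesOver K (ringClassField K ι ℓ) v w').toAlgebra
  have hℓp : ℓ.Prime := hℓ.1
  have hℓP : (Ideal.span {(ℓ : 𝓞 K)}).IsPrime := hℓ.2.2.2.2.1
  have hℓ0 : ℓ ≠ 0 := hℓp.ne_zero
  haveI := (finiteDimensional_and_isGalois_ringClassField hK ι hℓ0).1
  let e₀ : ringClassField K ι ℓ →ₐ[K] AlgebraicClosure K := IsAlgClosed.lift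
  obtain ⟨Φ, hker, hΦI, hsurj, hcyc, hcard⟩ := exists_ringClassCharacter K hK hD ι hℓp hℓP v hv e₀
  have hI := toLocal_apply_eq_of_mem_absInertia W K hp hℓ v hv k
  refine TransverseCup.cupProduct_eq_zero_of_principal_of_cyclic _ Φ a b (fun x ↦ ?_) (fun y ↦ ?_)
    (fun s x hx ↦ ?_) (fun s y hy ↦ ?_) (fun f hf ↦ ?_) (fun g hg ↦ ?_) ?_ (p ^ k / 2) (fun z ↦ ?_)
  · exact (GaloisRep.toLocal v ((W.baseChange K).torsionGaloisModule ((p ^ k : ℕ) : ℤ))).continuous_apply_left x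
  · exact (GaloisRep.toLocal v ((W.baseChange K).torsionGaloisModule ((p ^ k : ℕ) : ℤ))).continuous_apply_left y
  · exact apply_eq_self_of_forall_ker_of_inertia
      (GaloisRep.toLocal v ((W.baseChange K).torsionGaloisModule ((p ^ k : ℕ) : ℤ))) Φ hI hΦI s x hx
  · exact apply_eq_self_of_forall_ker_of_inertia
      (GaloisRep.toLocal v ((W.baseChange K).torsionGaloisModule ((p ^ k : ℕ) : ℤ))) Φ hI hΦI s y hy
  · rw [← hf] at ha
    obtain ⟨x, hx⟩ := (mem_transverseSubgroup_iff_exists_forall_range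
      (GaloisRep.toLocal v ((W.baseChange K).torsionGaloisModule ((p ^ k : ℕ) : ℤ))) _ f).1 ha
    exact ⟨x, fun h hh ↦ hx h ((ringClassCharacter_eq_one_iff_mem_range K hK ι hℓ0 v e₀ Φ hker w' h).1 hh)⟩
  · rw [← hg] at hb
    obtain ⟨y, hy⟩ := (mem_transverseSubgroup_iff_exists_forall_range
      (GaloisRep.toLocal v ((W.baseChange K).torsionGaloisModule ((p ^ k : ℕ) : ℤ))) _ g).1 hb
    exact ⟨y, fun h hh ↦ hy h ((ringClassCharacter_eq_one_iff_mem_range K hK ι hℓ0 v e₀ Φ hker w' h).1 hh)⟩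
  · -- the image `G_ℓ` is cyclic, `Φ` onto
    haveI : Finite (ringClassGalOver ι ℓ 1) := Nat.finite_of_card_ne_zero (by rw [hcard]; exact Nat.succ_ne_zero ℓ)
    obtain ⟨g₀, hg₀⟩ := IsCyclic.exists_monoid_generator (α := ringClassGalOver ι ℓ 1)
    obtain ⟨σ, hσ⟩ := hsurj g₀
    refine ⟨σ, fun s ↦ ?_⟩
    obtain ⟨i, hi⟩ := (Submonoid.mem_powers_iff _ _).mp (hg₀ (Φ s))
    exact ⟨i, by rw [hσ, hi]⟩
  · -- `p^k • μ_{p^k} = 0`, `p^k` odd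
    have hodd : Odd (p ^ k) := (hp.odd_of_ne_two hp2).pow
    rw [Nat.two_mul_div_two_add_one_of_odd hodd, ← natCast_zsmul]
    exact zsmul_muCarrier_eq_zero K (p ^ k) z

/-! ## §2 THE COUNT `#Tr = #E(K_λ)[p^k]` -/

/-- **`#H¹_tr(K_λ, E[p^k]) = #E(K_λ)[p^k]`** at a Kolyvagin prime `ℓ` with `k ≤ M(ℓ)` (Rubin PCMI
Prop. 1.9.5 (1) `H¹_tr ≅ Hom(Gal(L/F), A^{Frob=1})`, as a count): `Tr` is the image of the injective inflation from
the quotient `Γ_{K_λ}/ker Φ ≅ G_ℓ` (`infOne_exact_resSubgroup`), which is cyclic of order `ℓ + 1` and acts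
trivially on `E[p^k]^{ker Φ} = E[p^k]^{Γ_{K_λ}}`; so `#Tr = #Hom(G_ℓ, E[p^k]^{Γ}) = #(E[p^k]^{Γ})[ℓ+1] = #E[p^k]^{Γ}`
(`p^k ∣ ℓ + 1`) `= #E(K_λ)[p^k]` (`natCard_invariants_torsion_restrictField`).
[cite: Rubin2011, Prop. 1.9.5 (1) (p. 16)] [cite: MazurRubin2004, Lemma 1.2.1, Lemma 1.2.4] -/
theorem natCard_transverseSubgroup_ringClassField_eq (hK : IsImaginaryQuadratic K)
    (hD : NumberField.discr K < -4) (ι : K →+* ℂ) [∀ j : ℕ, NumberField (ringClassField K ι j)]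
    {p : ℕ} [hp : Fact p.Prime] (k : ℕ) [NeZero (p ^ k)]
    {ℓ : ℕ} (hℓ : Zhang2014.IsKolyvaginPrime (W.conductorNorm ℤ) W K p ℓ) (hkℓ : k ≤ Zhang2014.kolyvaginIndex W p ℓ)
    (v : HeightOneSpectrum (𝓞 K)) (hv : (ℓ : 𝓞 K) ∈ v.asIdeal)
    (w' : HeightOneSpectrum (𝓞 (ringClassField K ι ℓ))) [w'.asIdeal.LiesOver v.asIdeal] :
    Nat.card (letI := (adicCompletionOfLiesOver K (ringClassField K ι ℓ) v w').toAlgebra;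
      transverseSubgroup (GaloisRep.toLocal v ((W.baseChange K).torsionGaloisModule ((p ^ k : ℕ) : ℤ)))
        (w'.adicCompletion (ringClassField K ι ℓ))) =
    Nat.card (nsmulAddMonoidHom (p ^ k) :
      ((W.baseChange K).baseChange (v.adicCompletion K)).toAffine.Point →+ _).ker := by
  letI := (adicCompletionOfLiesOver K (ringClassField K ι ℓ) v w').toAlgebra
  have hℓp : ℓ.Prime := hℓ.1
  have hℓP : (Ideal.span {(ℓ : 𝓞 K)}).IsPrime := hℓ.2.2.2.2.1
  have hℓ0 : ℓ ≠ 0 := hℓp.ne_zero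
  haveI := (finiteDimensional_and_isGalois_ringClassField hK ι hℓ0).1
  haveI : CharZero (v.adicCompletion K) := charZero_adicCompletion v
  haveI : CharZero (w'.adicCompletion (ringClassField K ι ℓ)) := charZero_adicCompletion w'
  let e₀ : ringClassField K ι ℓ →ₐ[K] AlgebraicClosure K := IsAlgClosed.lift
  obtain ⟨Φ, hker, hΦI, hsurj, hcyc, hcard⟩ := exists_ringClassCharacter K hK hD ι hℓp hℓP v hv e₀
  have hI := toLocal_apply_eq_of_mem_absInertia W K hp.out hℓ v hv k
  let ρv := GaloisRep.toLocal v ((W.baseChange K).torsionGaloisModule ((p ^ k : ℕ) : ℤ))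
  set H : Subgroup (absoluteGaloisGroup (v.adicCompletion K)) := Φ.ker with hH
  -- `ker Φ` is the (closed) image of `Γ_{K[ℓ]_{w'}}`
  have hHset : (H : Set (absoluteGaloisGroup (v.adicCompletion K))) =
      Set.range (absGaloisRestrict (v.adicCompletion K) (w'.adicCompletion (ringClassField K ι ℓ))) := by
    ext d
    rw [SetLike.mem_coe, hH, MonoidHom.mem_ker]
    exact ringClassCharacter_eq_one_iff_mem_range K hK ι hℓ0 v e₀ Φ hker w' d
  haveI : IsClosed (H : Set (absoluteGaloisGroup (v.adicCompletion K))) := by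
    rw [hHset]; exact isClosed_range_absGaloisRestrict _ _
  -- transverse = image of the inflation from `Γ/H`
  have hex := infOne_exact_resSubgroup H ρv
  have hmem : ∀ c : galoisCohomology ρv 1,
      c ∈ transverseSubgroup ρv (w'.adicCompletion (ringClassField K ι ℓ)) ↔ c ∈ Set.range (infOne H ρv) := by
    intro c
    obtain ⟨φ, rfl⟩ := oneCocycleClass_surjective ρv.toTopRep c
    refine ((mem_transverseSubgroup_iff_exists_forall_range ρv _ φ).trans ?_).trans (hex _)
    rw [resSubgroup_oneCocycleClass, oneCocycleClass_eq_zero_iff]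
    constructor
    · rintro ⟨x, hx⟩
      refine ⟨x, fun h ↦ ?_⟩
      rw [contOneCocycles.pullback_apply]
      exact hx h.1 (by rw [← hHset]; exact h.2)
    · rintro ⟨x, hx⟩
      refine ⟨x, fun g hg ↦ ?_⟩
      have hg' : g ∈ H := by rw [← SetLike.mem_coe, hHset]; exact hg
      have h := hx ⟨g, hg'⟩
      rw [contOneCocycles.pullback_apply] at h
      exact h
  have einf : continuousCohomology 1 (ρv.quotientInvariants H).toTopRep ≃
      transverseSubgroup ρv (w'.adicCompletion (ringClassField K ι ℓ)) :=
    Equiv.ofBijective (fun x ↦ ⟨infOne H ρv x, (hmem _).mpr ⟨x, rfl⟩⟩)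
      ⟨fun x y hxy ↦ infOne_injective H ρv (congrArg Subtype.val hxy),
        fun c ↦ by
          obtain ⟨x, hx⟩ := (hmem c.1).mp c.2
          exact ⟨x, Subtype.ext hx⟩⟩
  rw [← Nat.card_congr einf]
  -- the quotient `Γ/H ≅ G_ℓ`: finite, discrete, cyclic of order `ℓ + 1`
  let eQ : absoluteGaloisGroup (v.adicCompletion K) ⧸ H ≃* ringClassGalOver ι ℓ 1 :=
    QuotientGroup.quotientKerEquivOfSurjective Φ hsurj
  haveI : Finite (ringClassGalOver ι ℓ 1) := Nat.finite_of_card_ne_zero (by rw [hcard]; exact Nat.succ_ne_zero ℓ)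
  haveI : Finite (absoluteGaloisGroup (v.adicCompletion K) ⧸ H) := Finite.of_equiv _ eQ.toEquiv.symm
  haveI : IsCyclic (absoluteGaloisGroup (v.adicCompletion K) ⧸ H) :=
    isCyclic_of_surjective eQ.symm.toMonoidHom eQ.symm.surjective
  have hcardQ : Nat.card (absoluteGaloisGroup (v.adicCompletion K) ⧸ H) = ℓ + 1 := by
    rw [Nat.card_congr eQ.toEquiv, hcard]
  haveI : H.FiniteIndex := Subgroup.finiteIndex_of_finite_quotient
  have hHopen : IsOpen (H : Set (absoluteGaloisGroup (v.adicCompletion K))) :=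
    Subgroup.isOpen_of_isClosed_of_finiteIndex H inferInstance
  haveI : DiscreteTopology (absoluteGaloisGroup (v.adicCompletion K) ⧸ H) := QuotientGroup.discreteTopology hHopen
  -- the quotient acts trivially on `M^H = M^{Γ}`
  have hfix : ∀ (g : absoluteGaloisGroup (v.adicCompletion K)) (a : ρv.invariantsOf H), ρv g a.1 = a.1 :=
    fun g a ↦ apply_eq_self_of_forall_ker_of_inertia ρv Φ hI hΦI g a.1
      (fun h hh ↦ (ContinuousRep.mem_invariantsOf_iff H ρv a.1).1 a.2 ⟨h, hh⟩)
  have htriv : ∀ (x : absoluteGaloisGroup (v.adicCompletion K) ⧸ H) (a : ρv.invariantsOf H),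
      ρv.quotientInvariants H x a = a := by
    intro x a
    obtain ⟨g, rfl⟩ := QuotientGroup.mk_surjective x
    apply Subtype.ext
    rw [ContinuousRep.quotientInvariants_apply_coe]
    exact hfix g a
  rw [natCard_continuousCohomology_one_eq_natCard_addMonoidHom_of_trivial _ htriv,
    natCard_addMonoidHom_of_isCyclic, hcardQ]
  -- every element of `M^H ⊆ E[p^k]` is killed by `ℓ + 1` (`p^k ∣ ℓ + 1`)
  obtain ⟨m, hm⟩ := (Zhang2014.le_kolyvaginIndex_iff.mp hkℓ).1
  have hall : ∀ a : ρv.invariantsOf H, ((ℓ + 1 : ℕ) : ℤ) • a = 0 := fun a ↦ by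
    apply Subtype.ext
    have hpk : ((p ^ k : ℕ) : ℤ) • (a : geomTorsion (W.baseChange K) ((p ^ k : ℕ) : ℤ)) = 0 := by
      rw [natCast_zsmul]
      exact AddSubgroup.torsionBy.nsmul _
    rw [Submodule.coe_smul, Submodule.coe_zero, hm, Nat.cast_mul, mul_comm, mul_smul, hpk, smul_zero]
  rw [Nat.card_congr (Equiv.subtypeUnivEquiv hall)]
  -- `M^H = M^{Γ_{K_λ}}`, counted by `natCard_invariants_torsion_restrictField`
  have e' : ρv.invariantsOf H ≃ ρv.toTopRep.ρ.invariants :=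
    { toFun := fun a ↦ ⟨a.1, fun g ↦ hfix g a⟩
      invFun := fun b ↦ ⟨b.1, (ContinuousRep.mem_invariantsOf_iff H ρv b.1).2 fun h ↦ b.2 h.1⟩
      left_inv := fun _ ↦ rfl
      right_inv := fun _ ↦ rfl }
  rw [Nat.card_congr e']
  change Nat.card (GaloisRep.restrictField (v.adicCompletion K)
      ((W.baseChange K).torsionGaloisModule ((p ^ k : ℕ) : ℤ))).toTopRep.ρ.invariants = _
  exact natCard_invariants_torsion_restrictField (W.baseChange K) (v.adicCompletion K) (NeZero.ne (p ^ k))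

end Summit.BirchSwinnertonDyer.Rank1Residual.JET.RingClassTransverse

end
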